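import Summits.Schanuel.Schanuel.Theorems.RootDecomp1BRadicalDescent01

/-!
# RootDecomp1BRadicalDescent — lens 4, generations 30–31 «RADICAL DESCENT / STOREY-TWO CELLS» (RadicalDescent.lean g31 47a8f674…, 1887 l) — continuation (RootDecomp1BRadicalDescent02): §B sizes (lengths, degrees, evaluation and determinant bounds; the degree-uniform measure `DExpMeasure`, `dExpMeasure_exp_of_LW`) + §C ultra-Liouville reals (`UltraLiouville`, dense `G_δ`, `exists_pos_ultraLiouville`)

(lens-4 g30/g31 `RadicalDescent.lean`, sha256 47a8f674…751d, own farm rc 0 · 0 sorry · axioms std; critic VERDICT STATUS L1626 (d) PORT GO LOW, SOURCE UPDATE L1648;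
port by census-1 gen 15 in six parts `RootDecomp1BRadicalDescent01`–`06` — see the PORT NOTE of part 01; `--supports stmt-Schanuel-24622`; rung 0.)
-/

noncomputable section

open Complex

namespace Summit.Schanuel.Schanuel.Theorems.RootDecomp1BRadicalDescent

/-! ## §B SIZES: lengths, degrees, evaluation and determinant bounds; the degree-uniform measure -/

section Sizes

open MvPolynomial
open Summit.Schanuel.Schanuel.Theorems.RootDecomp1KHyper (mvlen mvlen_nonneg mvlen_eq_sum_of_support_subset
  abs_coeff_le_mvlen one_le_mvlen LWMeasure)

variable {n : ℕ}

/-- The length of a monomial `c · x^m` is at most `|c|`. -/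
private theorem mvlen_monomial_le (m : Fin n →₀ ℕ) (c : ℤ) : mvlen (monomial m c) ≤ |c| := by
  classical
  rw [mvlen_eq_sum_of_support_subset _ support_monomial_subset, Finset.sum_singleton, coeff_monomial,
    if_pos rfl]

/-- The length of a constant `C c` is at most `|c|`. -/
private theorem mvlen_C_le (c : ℤ) : mvlen (C c : MvPolynomial (Fin n) ℤ) ≤ |c| := mvlen_monomial_le 0 c

/-- The length of the zero polynomial is `0`. -/
private theorem mvlen_zero : mvlen (0 : MvPolynomial (Fin n) ℤ) = 0 := by simp [mvlen]

/-- Subadditivity of the length. -/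
private theorem mvlen_add_le (P Q : MvPolynomial (Fin n) ℤ) : mvlen (P + Q) ≤ mvlen P + mvlen Q := by
  classical
  rw [mvlen_eq_sum_of_support_subset _ support_add,
    mvlen_eq_sum_of_support_subset P (Finset.subset_union_left (s₂ := Q.support)),
    mvlen_eq_sum_of_support_subset Q (Finset.subset_union_right (s₁ := P.support)),
    ← Finset.sum_add_distrib]
  exact Finset.sum_le_sum fun m _ => by rw [coeff_add]; exact abs_add_le _ _

/-- The length of a finite sum is at most the sum of the lengths. -/
private theorem mvlen_sum_le {ι : Type*} (s : Finset ι) (f : ι → MvPolynomial (Fin n) ℤ) :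
    mvlen (∑ i ∈ s, f i) ≤ ∑ i ∈ s, mvlen (f i) := by
  classical
  induction s using Finset.induction_on with
  | empty => simp [mvlen_zero]
  | insert a s ha ih =>
    rw [Finset.sum_insert ha, Finset.sum_insert ha]
    exact (mvlen_add_le _ _).trans (by linarith)

/-- `mvlen (P · c x^a) ≤ mvlen P · |c|`. -/
private theorem mvlen_mul_monomial_le (P : MvPolynomial (Fin n) ℤ) (a : Fin n →₀ ℕ) (b : ℤ) :
    mvlen (P * monomial a b) ≤ mvlen P * |b| := by
  classical
  have hP : P * monomial a b = ∑ m ∈ P.support, monomial (m + a) (P.coeff m * b) := by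
    conv_lhs => rw [P.as_sum]
    rw [Finset.sum_mul]
    exact Finset.sum_congr rfl fun m _ => monomial_mul
  rw [hP]
  calc mvlen (∑ m ∈ P.support, monomial (m + a) (P.coeff m * b))
      ≤ ∑ m ∈ P.support, mvlen (monomial (m + a) (P.coeff m * b)) := mvlen_sum_le _ _
    _ ≤ ∑ m ∈ P.support, |P.coeff m| * |b| :=
        Finset.sum_le_sum fun m _ => (mvlen_monomial_le _ _).trans_eq (abs_mul _ _)
    _ = mvlen P * |b| := by rw [← Finset.sum_mul]; rfl

/-- Submultiplicativity of the length: `mvlen (P Q) ≤ mvlen P · mvlen Q`. -/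
private theorem mvlen_mul_le (P Q : MvPolynomial (Fin n) ℤ) : mvlen (P * Q) ≤ mvlen P * mvlen Q := by
  classical
  have hQ : P * Q = ∑ a ∈ Q.support, P * monomial a (Q.coeff a) := by
    conv_lhs => rw [Q.as_sum]
    rw [Finset.mul_sum]
  rw [hQ]
  calc mvlen (∑ a ∈ Q.support, P * monomial a (Q.coeff a))
      ≤ ∑ a ∈ Q.support, mvlen (P * monomial a (Q.coeff a)) := mvlen_sum_le _ _
    _ ≤ ∑ a ∈ Q.support, mvlen P * |Q.coeff a| :=
        Finset.sum_le_sum fun a _ => mvlen_mul_monomial_le _ _ _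
    _ = mvlen P * mvlen Q := by rw [← Finset.mul_sum]; rfl

/-- `mvlen 1 ≤ 1`. -/
private theorem mvlen_one_le : mvlen (1 : MvPolynomial (Fin n) ℤ) ≤ 1 := by
  simpa using mvlen_C_le (n := n) 1

/-- The length of a finite product is at most the product of the lengths. -/
private theorem mvlen_prod_le {ι : Type*} (s : Finset ι) (f : ι → MvPolynomial (Fin n) ℤ) :
    mvlen (∏ i ∈ s, f i) ≤ ∏ i ∈ s, mvlen (f i) := by
  classical
  induction s using Finset.induction_on with
  | empty => simpa using mvlen_one_le
  | insert a s ha ih =>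
    rw [Finset.prod_insert ha, Finset.prod_insert ha]
    exact (mvlen_mul_le _ _).trans (mul_le_mul_of_nonneg_left ih (mvlen_nonneg _))

/-- Multiplying by a power of a variable does not increase the length. -/
private theorem mvlen_mul_X_pow_le (P : MvPolynomial (Fin n) ℤ) (i : Fin n) (e : ℕ) :
    mvlen (P * X i ^ e) ≤ mvlen P := by
  rw [X_pow_eq_monomial]
  simpa using mvlen_mul_monomial_le P (Finsupp.single i e) 1

/-- An integer cast into `ℤ[X₁,…,Xₙ]` is the constant `C k`. -/
private theorem intCast_eq_C (k : ℤ) : ((k : MvPolynomial (Fin n) ℤ)) = C k := by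
  rw [← map_intCast (C : ℤ →+* MvPolynomial (Fin n) ℤ) k, Int.cast_id]

/-- The length of an integer constant `k` is at most `|k|`. -/
private theorem mvlen_intCast_le (k : ℤ) : mvlen ((k : MvPolynomial (Fin n) ℤ)) ≤ |k| := by
  rw [intCast_eq_C]; exact mvlen_C_le k

/-- `‖P(θ)‖ ≤ len(P) · Θ^{deg P}` on the polydisc `‖θ_i‖ ≤ Θ`, `Θ ≥ 1`. -/
theorem norm_mvaeval_le_mvlen (P : MvPolynomial (Fin n) ℤ) (θ : Fin n → ℂ) {Θ : ℝ} (hΘ : 1 ≤ Θ)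
    (hθ : ∀ i, ‖θ i‖ ≤ Θ) : ‖aeval θ P‖ ≤ (mvlen P : ℝ) * Θ ^ P.totalDegree := by
  classical
  rw [MvPolynomial.aeval_def, MvPolynomial.eval₂_eq']
  refine (norm_sum_le _ _).trans ?_
  have hterm : ∀ s ∈ P.support,
      ‖(algebraMap ℤ ℂ) (P.coeff s) * ∏ i, θ i ^ s i‖ ≤ |((P.coeff s : ℤ) : ℝ)| * Θ ^ P.totalDegree := by
    intro s hs
    rw [norm_mul, algebraMap_int_eq, eq_intCast, Complex.norm_intCast, norm_prod]
    have hprod : ∏ i, ‖θ i ^ s i‖ ≤ Θ ^ P.totalDegree := by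
      calc ∏ i, ‖θ i ^ s i‖ = ∏ i, ‖θ i‖ ^ s i := by simp [norm_pow]
        _ ≤ ∏ i, Θ ^ s i := Finset.prod_le_prod (fun i _ => by positivity)
            (fun i _ => pow_le_pow_left₀ (norm_nonneg _) (hθ i) _)
        _ = Θ ^ ∑ i, s i := Finset.prod_pow_eq_pow_sum _ _ _
        _ ≤ Θ ^ P.totalDegree := pow_le_pow_right₀ hΘ (by
            have h := le_totalDegree hs
            rwa [Finsupp.sum_fintype _ _ (fun _ => rfl)] at h)
    exact mul_le_mul_of_nonneg_left hprod (abs_nonneg _)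
  calc ∑ s ∈ P.support, ‖(algebraMap ℤ ℂ) (P.coeff s) * ∏ i, θ i ^ s i‖
      ≤ ∑ s ∈ P.support, |((P.coeff s : ℤ) : ℝ)| * Θ ^ P.totalDegree := Finset.sum_le_sum hterm
    _ = (mvlen P : ℝ) * Θ ^ P.totalDegree := by
        rw [← Finset.sum_mul]
        unfold mvlen
        push_cast
        rfl

/-- Degree of a determinant with entries of degree `≤ δ`. -/
theorem totalDegree_det_le {q δ : ℕ} (N : Matrix (Fin q) (Fin q) (MvPolynomial (Fin n) ℤ))
    (hN : ∀ i j, (N i j).totalDegree ≤ δ) : N.det.totalDegree ≤ q * δ := by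
  rw [Matrix.det_apply']
  refine totalDegree_finsetSum_le fun σ _ => ?_
  refine (totalDegree_mul _ _).trans ?_
  rw [intCast_eq_C, totalDegree_C, zero_add]
  refine (totalDegree_finsetProd _ _).trans ?_
  calc ∑ i, (N (σ i) i).totalDegree ≤ ∑ _i : Fin q, δ := Finset.sum_le_sum fun i _ => hN _ _
    _ = q * δ := by simp

/-- Length of a determinant with entries of length `≤ E`. -/
theorem mvlen_det_le {q : ℕ} (N : Matrix (Fin q) (Fin q) (MvPolynomial (Fin n) ℤ)) {E : ℤ}
    (hN : ∀ i j, mvlen (N i j) ≤ E) : mvlen N.det ≤ (q.factorial : ℤ) * E ^ q := by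
  rw [Matrix.det_apply']
  calc mvlen (∑ σ : Equiv.Perm (Fin q), ((Equiv.Perm.sign σ : ℤ) : MvPolynomial (Fin n) ℤ) *
        ∏ i, N (σ i) i)
      ≤ ∑ σ : Equiv.Perm (Fin q), mvlen (((Equiv.Perm.sign σ : ℤ) : MvPolynomial (Fin n) ℤ) *
        ∏ i, N (σ i) i) := mvlen_sum_le _ _
    _ ≤ ∑ _σ : Equiv.Perm (Fin q), E ^ q := Finset.sum_le_sum fun σ _ => by
        have h1 : mvlen (((Equiv.Perm.sign σ : ℤ) : MvPolynomial (Fin n) ℤ)) ≤ 1 := by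
          refine (mvlen_intCast_le _).trans ?_
          rcases Int.units_eq_one_or (Equiv.Perm.sign σ) with h | h <;> simp [h]
        have h2 : mvlen (∏ i, N (σ i) i) ≤ E ^ q := by
          refine (mvlen_prod_le _ _).trans ?_
          calc ∏ i, mvlen (N (σ i) i) ≤ ∏ _i : Fin q, E :=
                Finset.prod_le_prod (fun i _ => mvlen_nonneg _) (fun i _ => hN _ _)
            _ = E ^ q := by simp
        calc mvlen (_ * _) ≤ mvlen _ * mvlen _ := mvlen_mul_le _ _
          _ ≤ 1 * E ^ q := mul_le_mul h1 h2 (mvlen_nonneg _) zero_le_one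
          _ = E ^ q := one_mul _
    _ = (q.factorial : ℤ) * E ^ q := by simp [Fintype.card_perm, Fintype.card_fin]

/-- Length and degree of the adjugate entries. -/
theorem adjugate_bounds {q δ : ℕ} (N : Matrix (Fin q) (Fin q) (MvPolynomial (Fin n) ℤ)) {E : ℤ}
    (hE : 1 ≤ E) (hN : ∀ i j, mvlen (N i j) ≤ E) (hN' : ∀ i j, (N i j).totalDegree ≤ δ)
    (i j : Fin q) :
    mvlen (N.adjugate i j) ≤ (q.factorial : ℤ) * E ^ q ∧ (N.adjugate i j).totalDegree ≤ q * δ := by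
  classical
  rw [Matrix.adjugate_apply]
  have h1 : ∀ a b, mvlen (N.updateRow j (Pi.single i 1) a b) ≤ E := by
    intro a b
    rw [Matrix.updateRow_apply]
    split_ifs
    · rw [Pi.single_apply]
      split_ifs
      · exact mvlen_one_le.trans hE
      · rw [mvlen_zero]; linarith
    · exact hN a b
  have h2 : ∀ a b, (N.updateRow j (Pi.single i 1) a b).totalDegree ≤ δ := by
    intro a b
    rw [Matrix.updateRow_apply]
    split_ifs
    · rw [Pi.single_apply]
      split_ifs <;> simp
    · exact hN' a b
  exact ⟨mvlen_det_le _ h1, totalDegree_det_le _ h2⟩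

/-- **A measure of algebraic independence UNIFORM IN THE DEGREE**, doubly exponential in the degree:
`‖P(θ)‖ ≥ exp(−(log len P + 1) · exp(A (deg P + 1)^A))` for every nonzero integer `P`. -/
def DExpMeasure (θ : Fin n → ℂ) : Prop :=
  ∃ A : ℕ, ∀ P : MvPolynomial (Fin n) ℤ, P ≠ 0 →
    Real.exp (-((Real.log (mvlen P : ℝ) + 1) * Real.exp ((A : ℝ) * ((P.totalDegree : ℝ) + 1) ^ A))) ≤
      ‖MvPolynomial.aeval θ P‖

/-- **The Lindemann–Weierstrass measure (Ably 1994, `LWMeasure`, degree-uniform) gives a `DExpMeasure`**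
for `θ = (e^{y_1}, …, e^{y_n})`, `y` algebraic and ℚ-free. -/
theorem dExpMeasure_exp_of_LW (hLW : LWMeasure) {y : Fin n → ℂ} (hy : ∀ i, IsAlgebraic ℚ (y i))
    (hli : LinearIndependent ℚ y) : DExpMeasure (fun i => cexp (y i)) := by
  obtain ⟨C, c₂, hC, hc₂, hmeas⟩ := hLW n y hy hli
  refine ⟨⌈c₂ + 1 + C⌉₊ + n + 1, fun P hP => ?_⟩
  set A : ℕ := ⌈c₂ + 1 + C⌉₊ + n + 1 with hA
  set D : ℕ := P.totalDegree with hD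
  set H : ℕ := (mvlen P).toNat with hH
  have hH1 : (H : ℤ) = mvlen P := Int.toNat_of_nonneg (mvlen_nonneg P)
  have hHpos : 1 ≤ (H : ℝ) := by
    have : (1 : ℤ) ≤ H := hH1 ▸ one_le_mvlen hP
    exact_mod_cast this
  have hcoef : ∀ m, |P.coeff m| ≤ (H : ℤ) := fun m => hH1 ▸ abs_coeff_le_mvlen P m
  have h := hmeas P D H hP le_rfl hcoef
  refine le_trans ?_ h
  rw [Real.exp_le_exp, neg_le_neg_iff]
  have hmv : ((mvlen P : ℤ) : ℝ) = (H : ℝ) := by exact_mod_cast hH1.symm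
  rw [hmv]
  set L := Real.log (H : ℝ) with hL
  have hL0 : 0 ≤ L := Real.log_nonneg hHpos
  set d : ℝ := (D : ℝ) + 1 with hd
  have hD0 : (0 : ℝ) ≤ D := Nat.cast_nonneg _
  have hd1 : 1 ≤ d := by rw [hd]; linarith
  have hDn : (D : ℝ) ^ n ≤ d ^ n := pow_le_pow_left₀ hD0 (by rw [hd]; linarith) n
  have hdn0 : 0 ≤ d ^ n := by positivity
  have hB : c₂ + d ^ n + C * d ^ (n + 1) ≤ (A : ℝ) * d ^ A := by
    have hA1 : c₂ + 1 + C ≤ (A : ℝ) := by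
      have := Nat.le_ceil (c₂ + 1 + C)
      rw [hA]; push_cast; linarith
    have hdA : d ^ (n + 1) ≤ d ^ A := pow_le_pow_right₀ hd1 (by rw [hA]; omega)
    have hdn : d ^ n ≤ d ^ (n + 1) := pow_le_pow_right₀ hd1 (by omega)
    have hd0 : 1 ≤ d ^ (n + 1) := one_le_pow₀ hd1
    have hA0 : (0 : ℝ) ≤ A := Nat.cast_nonneg _
    calc c₂ + d ^ n + C * d ^ (n + 1) ≤ c₂ * d ^ (n + 1) + d ^ (n + 1) + C * d ^ (n + 1) := by
          nlinarith
      _ = (c₂ + 1 + C) * d ^ (n + 1) := by ring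
      _ ≤ (A : ℝ) * d ^ (n + 1) := mul_le_mul_of_nonneg_right hA1 (by positivity)
      _ ≤ (A : ℝ) * d ^ A := mul_le_mul_of_nonneg_left hdA hA0
  -- (a) c₂ D^n ≤ exp (c₂ + d^n)
  have ha : c₂ * (D : ℝ) ^ n ≤ Real.exp (c₂ + d ^ n) := by
    rw [Real.exp_add]
    have h1 : c₂ ≤ Real.exp c₂ := by linarith [Real.add_one_le_exp c₂]
    have h2 : (D : ℝ) ^ n ≤ Real.exp (d ^ n) := hDn.trans (by linarith [Real.add_one_le_exp (d ^ n)])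
    exact mul_le_mul h1 h2 (by positivity) (Real.exp_pos _).le
  -- (b) exp (C D^n log (D+1)) ≤ exp (C d^(n+1))
  have hb : Real.exp (C * (D : ℝ) ^ n * Real.log ((D : ℝ) + 1)) ≤ Real.exp (C * d ^ (n + 1)) := by
    rw [Real.exp_le_exp, pow_succ]
    have hlog : Real.log ((D : ℝ) + 1) ≤ d := by
      rw [← hd]; linarith [Real.log_le_sub_one_of_pos (show 0 < d by linarith)]
    have hlog0 : 0 ≤ Real.log ((D : ℝ) + 1) := Real.log_nonneg (by linarith)
    calc C * (D : ℝ) ^ n * Real.log ((D : ℝ) + 1) ≤ C * d ^ n * d := by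
          have := mul_le_mul hDn hlog hlog0 hdn0
          nlinarith
      _ = C * (d ^ n * d) := by ring
  have hE1 : 1 ≤ Real.exp (C * d ^ (n + 1)) := Real.one_le_exp (by positivity)
  calc c₂ * (D : ℝ) ^ n * (L + Real.exp (C * (D : ℝ) ^ n * Real.log ((D : ℝ) + 1)))
      ≤ Real.exp (c₂ + d ^ n) * (L + Real.exp (C * d ^ (n + 1))) := by
        have hx : 0 ≤ L + Real.exp (C * (D : ℝ) ^ n * Real.log ((D : ℝ) + 1)) := by positivity
        nlinarith [Real.exp_pos (c₂ + d ^ n)]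
    _ ≤ Real.exp (c₂ + d ^ n) * ((L + 1) * Real.exp (C * d ^ (n + 1))) := by
        refine mul_le_mul_of_nonneg_left ?_ (Real.exp_pos _).le
        nlinarith
    _ = (L + 1) * Real.exp (c₂ + d ^ n + C * d ^ (n + 1)) := by rw [Real.exp_add (c₂ + d ^ n)]; ring
    _ ≤ (L + 1) * Real.exp ((A : ℝ) * d ^ A) := by
        refine mul_le_mul_of_nonneg_left (Real.exp_le_exp.2 hB) (by positivity)

end Sizes

/-! ## §C ULTRA-LIOUVILLE REALS: `|ρ − p/q| < exp(−exp(q^m))` for every `m` -/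

section Ultra

open Summit.Schanuel.Schanuel.Theorems.RootDecomp1KHyper.HyperCell (HyperLiouville exists_rat_den_ge_near)

/-- **Ultra-Liouville reals**: for every `m` a rational `r = p/q ≠ ρ` with `q ≥ m` and
`|ρ − r| < exp(−exp(q^m))`.  A dense `G_δ` (hence comeagre) class of reals, inside the hyper-Liouville
(hence Liouville) reals. -/
def UltraLiouville (ρ : ℝ) : Prop :=
  ∀ m : ℕ, ∃ r : ℚ, m ≤ r.den ∧ ρ ≠ r ∧ |ρ - r| < Real.exp (-Real.exp ((r.den : ℝ) ^ m))

variable {ρ : ℝ}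

/-- Ultra-Liouville reals are hyper-Liouville. -/
theorem UltraLiouville.hyperLiouville (h : UltraLiouville ρ) : HyperLiouville ρ := by
  intro m
  obtain ⟨r, hr, hne, hlt⟩ := h m
  refine ⟨r, hr, hne, hlt.trans_le (Real.exp_le_exp.2 (neg_le_neg ?_))⟩
  linarith [Real.add_one_le_exp (((r.den : ℝ)) ^ m)]

/-- Ultra-Liouville reals are Liouville. -/
theorem UltraLiouville.liouville (h : UltraLiouville ρ) : Liouville ρ := h.hyperLiouville.liouville

/-- Ultra-Liouville reals are irrational. -/
theorem UltraLiouville.irrational (h : UltraLiouville ρ) : Irrational ρ := h.hyperLiouville.irrational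

/-- approximations of every order `m` with denominator above any threshold `Q`. -/
theorem UltraLiouville.exists_den_ge (h : UltraLiouville ρ) (m Q : ℕ) :
    ∃ r : ℚ, Q ≤ r.den ∧ m ≤ r.den ∧ ρ ≠ r ∧ |ρ - r| < Real.exp (-Real.exp ((r.den : ℝ) ^ m)) := by
  obtain ⟨r, hr, hne, hlt⟩ := h (max m Q)
  refine ⟨r, (le_max_right _ _).trans hr, (le_max_left _ _).trans hr, hne, hlt.trans_le ?_⟩
  rw [Real.exp_le_exp, neg_le_neg_iff, Real.exp_le_exp]
  exact pow_le_pow_right₀ (by exact_mod_cast r.pos) (le_max_left _ _)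

open Topology in
/-- **Ultra-Liouville reals are dense** (Baire: `⋂_m ⋃_{den r ≥ m} B(r, e^{−e^{den^m}}) ∖ {r}` is a
dense `G_δ`). Verbatim adaptation of the tree's `dense_setOf_hyperLiouville`. -/
theorem dense_setOf_ultraLiouville : Dense {ρ : ℝ | UltraLiouville ρ} := by
  let U : ℕ → Set ℝ := fun m => ⋃ r : {r : ℚ // m ≤ r.den},
    Metric.ball ((r : ℚ) : ℝ) (Real.exp (-Real.exp ((((r : ℚ).den : ℝ)) ^ m))) \ {((r : ℚ) : ℝ)}
  have hsub : (⋂ m, U m) ⊆ {ρ : ℝ | UltraLiouville ρ} := by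
    intro ρ hρ m
    have hm := Set.mem_iInter.mp hρ m
    obtain ⟨⟨r, hr⟩, hmem⟩ := Set.mem_iUnion.mp hm
    refine ⟨r, hr, fun h => hmem.2 (by simpa using h), ?_⟩
    have := hmem.1
    rw [Metric.mem_ball, Real.dist_eq] at this
    exact this
  refine Dense.mono hsub (dense_iInter_of_isOpen (fun m => ?_) (fun m => ?_))
  · exact isOpen_iUnion fun r => Metric.isOpen_ball.sdiff isClosed_singleton
  · rw [Metric.dense_iff]
    intro x ε hε
    obtain ⟨r, hr, hxr⟩ := exists_rat_den_ge_near x (half_pos hε) m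
    set t : ℝ := min (Real.exp (-Real.exp (((r.den : ℝ)) ^ m))) ε / 2 with ht
    have ht0 : 0 < t := by positivity
    have hte : t < Real.exp (-Real.exp (((r.den : ℝ)) ^ m)) := by
      have := min_le_left (Real.exp (-Real.exp (((r.den : ℝ)) ^ m))) ε
      have := Real.exp_pos (-Real.exp (((r.den : ℝ)) ^ m))
      rw [ht]; linarith
    have htε : t ≤ ε / 2 := by
      have := min_le_right (Real.exp (-Real.exp (((r.den : ℝ)) ^ m))) ε
      rw [ht]; linarith
    refine ⟨(r : ℝ) + t, ?_, ?_⟩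
    · rw [Metric.mem_ball, Real.dist_eq]
      calc |(r : ℝ) + t - x| = |t + (r - x)| := by ring_nf
        _ ≤ |t| + |(r : ℝ) - x| := abs_add_le _ _
        _ < ε / 2 + ε / 2 := by
            rw [abs_of_pos ht0, abs_sub_comm]
            exact add_lt_add_of_le_of_lt htε hxr
        _ = ε := by ring
    · refine Set.mem_iUnion.mpr ⟨⟨r, hr⟩, ?_, ?_⟩
      · rw [Metric.mem_ball, Real.dist_eq]
        simpa [abs_of_pos ht0] using hte
      · simp only [Set.mem_singleton_iff]
        intro h
        have : t = 0 := by linarith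
        exact ht0.ne' this

/-- Ultra-Liouville reals exist. -/
theorem exists_ultraLiouville : ∃ ρ : ℝ, UltraLiouville ρ := dense_setOf_ultraLiouville.nonempty

/-- Positive ultra-Liouville reals exist. -/
theorem exists_pos_ultraLiouville : ∃ ρ : ℝ, 0 < ρ ∧ UltraLiouville ρ := by
  obtain ⟨ρ, hρ, hρpos⟩ :=
    dense_setOf_ultraLiouville.exists_mem_open isOpen_Ioi ⟨1, Set.mem_Ioi.mpr one_pos⟩
  exact ⟨ρ, Set.mem_Ioi.mp hρpos, hρ⟩

end Ultra

end Summit.Schanuel.Schanuel.Theorems.RootDecomp1BRadicalDescent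

end
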